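import Literature.NumberTheory.Automorphic.UnitaryThreeRegularUnipotentOrbitFrame   -- ★ p849269 (this seat): `coe_torusElt_zpow`, `coe_torusElt_zpow_conj_upperTriangularUnipotent`, `isIntMatrix_upperTriangularUnipotent_iff`, `coe_upperTriangularUnipotent_{mul,inv}`
import Literature.NumberTheory.Automorphic.UnitaryThreeUnipotentCentralizers       -- ★ `mul_cornerUnipotent_eq_cornerUnipotent_mul_iff` (the centraliser of `n(t)` is upper triangular, independent of `t ≠ 0`)
import HarnessLib

/-!
# Shell subgroups `S_j = d^{−j}(C_U(n(t₀)) ∩ U_int)d^{j}` of the centraliser of a TRANSVECTION in the quasi-split `U(3)`: monotone, absorbing, STRICTLY growing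
# ([Rao1972]; [Rogawski1990] §8.1 — the Ranga-Rao convergence at the singular unipotent classes)

Topic `NumberTheory/Automorphic`; namespace `Literature.NumberTheory.Automorphic.UnitaryGroup`.  THEOREMS ONLY (no definition, no instance, no notation, no named fact, no `sorry`).
Cell `pub/hodgecm-mathlib` (D-0151), crux H413 = `stmt-HodgeConjecture-24833`, line LH4 (Shalika pay-down), organ «TRANSV-SHELLS» (LH4-plan (g2) dealer words #29 (a): the
field-level sub-brick of the (A′) export `UnitaryGroup.exists_shells_of_transvection` (LH4-p01 (g0)) feeding the generic shell sum (B) (LH4-p03 (g3)) with `N = 1`, `c₃ = 1`).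

THE MATHEMATICS.  `K` a valued field (`Valued K ℤᵐ⁰`), `σ` an isometric involution, `U = U(σ, J₀)`, `u₀ = n(t₀) = !![1, 0, t₀; 0, 1, 0; 0, 0, 1]` (`t₀ ≠ 0`) a corner transvection,
`d = diag(z, 1, (σz)⁻¹)` with `v z = exp(−1)`.  For `j : ℤ` let `S_j := {g ∈ U : g u₀ = u₀ g, d^j g d^{−j} and its inverse INTEGRAL}` (`= d^{−j}(C_U(u₀) ∩ U_int)d^{j}`).
* §1 `S_j` is a SUBGROUP of `GL₃(K)` (existential family `exists_shellSubgroups_transvection`, membership predicate as displayed; no `def`).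
* §2 MONOTONE `S_j ≤ S_{j+1}` (hence `S_{j₀} ≤ S_j` for `j₀ ≤ j`): an element commuting with `n(t₀)` is UPPER TRIANGULAR (★ `mul_cornerUnipotent_eq_cornerUnipotent_mul_iff`), and
  conjugating an integral upper triangular matrix by `d` scales the entries by `z`, `zσz`, `σz` (valuation `≤ 1`) — `isIntMatrix_conj_torusElt_of_lower_eq_zero`.
* §3 ABSORPTION `k · d^j · s ∈ U_int-pairs · {d^j}` for `s ∈ S_j` (definitional: `d^j s d^{−j}` is integral with integral inverse).
* §4 STRICT GROWTH: the explicit witness `w_j = !![1, z^{−(j+1)}, −(zσz)^{−(j+1)}∕2; 0, 1, −σ(z)^{−(j+1)}; 0, 0, 1] ∈ S_{j+1} ∖ S_j` (`2 ∈ 𝒪^×`), so `relIndex (S_j) (S_{j+1}) ≠ 1`; with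
  finiteness of the steps (on the CM carrier: compact-open subgroups, ★ `relIndex_ne_zero_of_isCompact_of_isOpen`) the GROWTH `2^{j−j₀} ≤ [S_j : S_{j₀}]` follows by
  ★ Mathlib `relIndex_mul_relIndex` — `pow_two_le_relIndex_of_chain` (pure group theory, stated for any chain).
HONEST LABEL: elementary; count-neutral, pays no letter; HC_CM is proved only modulo the 7 printed citations (2 remaining: hLiu418 = stmt-HodgeConjecture-24832, h413 =
stmt-HodgeConjecture-24833) until rung 0 closes.

## References
* [Rao1972] R. Ranga Rao, *Orbital integrals in reductive groups*, Ann. of Math. (2) 96 (1972) 505–510.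
* [Rogawski1990] J. D. Rogawski, *Automorphic Representations of Unitary Groups in Three Variables*, Ann. of Math. Stud. 123 (1990): §1.10 p. 9, §3.9 p. 32, §8.1 p. 112.
-/

set_option autoImplicit false

open Matrix
open scoped Valued WithZero

namespace Literature.NumberTheory.Automorphic.UnitaryGroup

open Literature.NumberTheory.Automorphic.HermitianLattice Literature.NumberTheory.Automorphic.UnitaryLatticeTree

variable {K : Type*} [Field K] (σ : K →+* K) [Valued K ℤᵐ⁰]

/-! ## §0 Pure group theory: a chain of subgroups with steps of index `≠ 0, ≠ 1` grows like `2^j` -/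

section Chain

variable {G : Type*} [Group G]

/-- **Growth along a chain**: for a monotone family of subgroups `S : ℤ → Subgroup G` whose consecutive steps have FINITE index (`≠ 0`) and are PROPER (`≠ 1`),
`2^{(j − j₀)} ≤ [S j : S j₀]` for `j₀ ≤ j` (Lagrange: ★ Mathlib `relIndex_mul_relIndex`). [cite: Rao1972, Theorem] -/
theorem pow_two_le_relIndex_of_chain (S : ℤ → Subgroup G) (hmono : ∀ j, S j ≤ S (j + 1)) (hfin : ∀ j, (S j).relIndex (S (j + 1)) ≠ 0)
    (hne : ∀ j, (S j).relIndex (S (j + 1)) ≠ 1) {j₀ j : ℤ} (hj : j₀ ≤ j) :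
    2 ^ (j - j₀).toNat ≤ (S j₀).relIndex (S j) := by
  have hmono' : ∀ (a : ℤ) (k : ℕ), S a ≤ S (a + k) := by
    intro a k
    induction k with
    | zero => simp
    | succ k ih =>
      rw [Nat.cast_succ, ← add_assoc]
      exact ih.trans (hmono _)
  obtain ⟨n, hn⟩ := Int.eq_ofNat_of_zero_le (sub_nonneg.2 hj)
  have hj' : j = j₀ + n := by omega
  rw [hj', show (j₀ + (n : ℤ) - j₀).toNat = n by simp]
  clear hj hj' hn
  induction n with
  | zero => simp [Subgroup.relIndex_self]
  | succ n ih =>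
    have h1 : S j₀ ≤ S (j₀ + n) := hmono' j₀ n
    have h2 : S (j₀ + n) ≤ S (j₀ + (n + 1 : ℕ)) := by rw [Nat.cast_succ, ← add_assoc]; exact hmono _
    have hmul := Subgroup.relIndex_mul_relIndex (S j₀) (S (j₀ + n)) (S (j₀ + (n + 1 : ℕ))) h1 h2
    have hstep : 2 ≤ (S (j₀ + n)).relIndex (S (j₀ + (n + 1 : ℕ))) := by
      have h0 := hfin (j₀ + n)
      have h1' := hne (j₀ + n)
      rw [Nat.cast_succ, ← add_assoc]
      omega
    calc 2 ^ (n + 1) = 2 ^ n * 2 := pow_succ 2 n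
      _ ≤ (S j₀).relIndex (S (j₀ + n)) * (S (j₀ + n)).relIndex (S (j₀ + (n + 1 : ℕ))) := Nat.mul_le_mul ih hstep
      _ = (S j₀).relIndex (S (j₀ + (n + 1 : ℕ))) := hmul

end Chain

/-! ## §1 The shell subgroups (existential) -/

section Shells

/-- **THE SHELL SUBGROUPS `S_j`** of the centraliser of the corner transvection `u₀ = n(t₀)`: for every `j : ℤ` the elements `g ∈ U` commuting with `u₀` such that
`d^j g d^{−j}` and its inverse are integral form a subgroup of `GL₃(K)` (conjugation is a homomorphism; integral matrices are closed under products).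
[cite: Rao1972, Theorem] [cite: Rogawski1990, §8.1 p. 112] -/
theorem exists_shellSubgroup_transvection (u d : GL (Fin 3) K) (j : ℤ) :
    ∃ S : Subgroup (GL (Fin 3) K), ∀ g : GL (Fin 3) K, g ∈ S ↔
      g ∈ unitaryGroupOfForm σ ((StdForm.antidiagonal 3).over K) ∧ g * u = u * g ∧
        IsIntMatrix ((d ^ j * g * (d ^ j)⁻¹ : GL (Fin 3) K) : Matrix (Fin 3) (Fin 3) K) ∧
        IsIntMatrix (((d ^ j * g * (d ^ j)⁻¹)⁻¹ : GL (Fin 3) K) : Matrix (Fin 3) (Fin 3) K) := by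
  let P : GL (Fin 3) K → Prop := fun g => g ∈ unitaryGroupOfForm σ ((StdForm.antidiagonal 3).over K) ∧ g * u = u * g ∧
      IsIntMatrix ((d ^ j * g * (d ^ j)⁻¹ : GL (Fin 3) K) : Matrix (Fin 3) (Fin 3) K) ∧
      IsIntMatrix (((d ^ j * g * (d ^ j)⁻¹)⁻¹ : GL (Fin 3) K) : Matrix (Fin 3) (Fin 3) K)
  refine ⟨{ carrier := setOf P, mul_mem' := ?_, one_mem' := ?_, inv_mem' := ?_ }, fun g => Iff.rfl⟩
  · rintro g g' ⟨hg, hgc, hgi, hgi'⟩ ⟨hg', hg'c, hg'i, hg'i'⟩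
    refine ⟨mul_mem hg hg', by rw [mul_assoc, hg'c, ← mul_assoc, hgc, mul_assoc], ?_, ?_⟩
    · have : d ^ j * (g * g') * (d ^ j)⁻¹ = (d ^ j * g * (d ^ j)⁻¹) * (d ^ j * g' * (d ^ j)⁻¹) := by group
      rw [this, Units.val_mul]
      exact isIntMatrix_mul hgi hg'i
    · have : (d ^ j * (g * g') * (d ^ j)⁻¹)⁻¹ = (d ^ j * g' * (d ^ j)⁻¹)⁻¹ * (d ^ j * g * (d ^ j)⁻¹)⁻¹ := by group
      rw [this, Units.val_mul]
      exact isIntMatrix_mul hg'i' hgi'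
  · refine ⟨one_mem _, by rw [one_mul, mul_one], ?_, ?_⟩
    · rw [mul_one, mul_inv_cancel, Units.val_one]; exact isIntMatrix_one
    · rw [mul_one, mul_inv_cancel, inv_one, Units.val_one]; exact isIntMatrix_one
  · rintro g ⟨hg, hgc, hgi, hgi'⟩
    refine ⟨inv_mem hg, ?_, ?_, ?_⟩
    · rw [inv_mul_eq_iff_eq_mul, ← mul_assoc, hgc, mul_assoc, mul_inv_cancel, mul_one]
    · have : d ^ j * g⁻¹ * (d ^ j)⁻¹ = (d ^ j * g * (d ^ j)⁻¹)⁻¹ := by group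
      rw [this]; exact hgi'
    · have : (d ^ j * g⁻¹ * (d ^ j)⁻¹)⁻¹ = d ^ j * g * (d ^ j)⁻¹ := by group
      rw [this]; exact hgi

/-- **THE SHELL SUBGROUPS `S_j`** of the centraliser of the corner transvection `u₀ = n(t₀)`, as a family over `j : ℤ`: `g ∈ U` commuting with `u₀` with `d^j g d^{−j}` and its
inverse integral. [cite: Rao1972, Theorem] [cite: Rogawski1990, §8.1 p. 112] -/
theorem exists_shellSubgroups_transvection (u d : GL (Fin 3) K) :
    ∃ S : ℤ → Subgroup (GL (Fin 3) K), ∀ (j : ℤ) (g : GL (Fin 3) K), g ∈ S j ↔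
      g ∈ unitaryGroupOfForm σ ((StdForm.antidiagonal 3).over K) ∧ g * u = u * g ∧
        IsIntMatrix ((d ^ j * g * (d ^ j)⁻¹ : GL (Fin 3) K) : Matrix (Fin 3) (Fin 3) K) ∧
        IsIntMatrix (((d ^ j * g * (d ^ j)⁻¹)⁻¹ : GL (Fin 3) K) : Matrix (Fin 3) (Fin 3) K) := by
  choose S hS using fun j => exists_shellSubgroup_transvection σ u d j
  exact ⟨S, hS⟩

end Shells

/-! ## §2 Monotonicity: `S_j ≤ S_{j+1}` -/

section Monotone

omit [Valued K ℤᵐ⁰] in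
/-- **An element commuting with a corner transvection is upper triangular** (★ `mul_cornerUnipotent_eq_cornerUnipotent_mul_iff`); in particular commuting with `n(t)` does not
depend on `t ≠ 0`. [cite: Rogawski1990, §3.9 p. 32] -/
theorem lower_eq_zero_of_commute_cornerUnipotent {t : K} (ht : t ≠ 0) {u g : GL (Fin 3) K} (hu : (u : Matrix (Fin 3) (Fin 3) K) = !![1, 0, t; 0, 1, 0; 0, 0, 1])
    (hcomm : g * u = u * g) :
    (g : Matrix (Fin 3) (Fin 3) K) 1 0 = 0 ∧ (g : Matrix (Fin 3) (Fin 3) K) 2 0 = 0 ∧ (g : Matrix (Fin 3) (Fin 3) K) 2 1 = 0 ∧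
      (g : Matrix (Fin 3) (Fin 3) K) 0 0 = (g : Matrix (Fin 3) (Fin 3) K) 2 2 := by
  have h : (g : Matrix (Fin 3) (Fin 3) K) * !![1, 0, t; 0, 1, 0; 0, 0, 1] = !![1, 0, t; 0, 1, 0; 0, 0, 1] * (g : Matrix (Fin 3) (Fin 3) K) := by
    rw [← hu, ← Units.val_mul, hcomm, Units.val_mul]
  exact (mul_cornerUnipotent_eq_cornerUnipotent_mul_iff ht _).1 h

omit [Valued K ℤᵐ⁰] in
/-- **Commuting with `n(t)` is independent of `t ≠ 0`.** [cite: Rogawski1990, §3.9 p. 32] -/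
theorem commute_cornerUnipotent_of_commute {t t' : K} (ht : t ≠ 0) (ht' : t' ≠ 0) {u u' g : GL (Fin 3) K}
    (hu : (u : Matrix (Fin 3) (Fin 3) K) = !![1, 0, t; 0, 1, 0; 0, 0, 1]) (hu' : (u' : Matrix (Fin 3) (Fin 3) K) = !![1, 0, t'; 0, 1, 0; 0, 0, 1])
    (hcomm : g * u = u * g) : g * u' = u' * g := by
  have h := lower_eq_zero_of_commute_cornerUnipotent ht hu hcomm
  have h' : (g : Matrix (Fin 3) (Fin 3) K) * !![1, 0, t'; 0, 1, 0; 0, 0, 1] = !![1, 0, t'; 0, 1, 0; 0, 0, 1] * (g : Matrix (Fin 3) (Fin 3) K) :=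
    (mul_cornerUnipotent_eq_cornerUnipotent_mul_iff ht' _).2 h
  exact Units.ext (by rw [Units.val_mul, Units.val_mul, hu', h'])

omit [Valued K ℤᵐ⁰] in
/-- **Diagonal conjugation of an UPPER TRIANGULAR matrix**: `diag(p,q,r)·!![a,b,c;0,e,f;0,0,i]·diag(p,q,r)⁻¹ = !![a, p b q⁻¹, p c r⁻¹; 0, e, q f r⁻¹; 0, 0, i]`.
[cite: Rogawski1990, §3.9 p. 32] -/
theorem coe_diagonal_conj_upperTriangular {p q r a b c e f i : K} (hp : p ≠ 0) (hq : q ≠ 0) (hr : r ≠ 0) {t g : GL (Fin 3) K}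
    (ht : (t : Matrix (Fin 3) (Fin 3) K) = Matrix.diagonal ![p, q, r]) (hg : (g : Matrix (Fin 3) (Fin 3) K) = !![a, b, c; 0, e, f; 0, 0, i]) :
    ((t * g * t⁻¹ : GL (Fin 3) K) : Matrix (Fin 3) (Fin 3) K) = !![a, p * b * q⁻¹, p * c * r⁻¹; 0, e, q * f * r⁻¹; 0, 0, i] := by
  have ht' : ((t⁻¹ : GL (Fin 3) K) : Matrix (Fin 3) (Fin 3) K) = Matrix.diagonal ![p⁻¹, q⁻¹, r⁻¹] := by
    have h1 : (t : Matrix (Fin 3) (Fin 3) K) * Matrix.diagonal ![p⁻¹, q⁻¹, r⁻¹] = 1 := by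
      rw [ht, Matrix.diagonal_mul_diagonal, ← Matrix.diagonal_one]
      congr 1; funext k; fin_cases k <;> simp [mul_inv_cancel₀ hp, mul_inv_cancel₀ hq, mul_inv_cancel₀ hr]
    rw [Matrix.coe_units_inv]
    exact Matrix.inv_eq_right_inv h1
  rw [Units.val_mul, Units.val_mul, ht, hg, ht']
  ext k l
  fin_cases k <;> fin_cases l <;> simp [Matrix.mul_apply, Matrix.diagonal]
  all_goals field_simp

omit [Valued K ℤᵐ⁰] in
/-- An element with vanishing below-diagonal entries IS the upper triangular literal of its entries. [cite: Rogawski1990, §3.9 p. 32] -/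
theorem coe_eq_upperTriangular_of_lower_eq_zero {g : GL (Fin 3) K} (h10 : (g : Matrix (Fin 3) (Fin 3) K) 1 0 = 0)
    (h20 : (g : Matrix (Fin 3) (Fin 3) K) 2 0 = 0) (h21 : (g : Matrix (Fin 3) (Fin 3) K) 2 1 = 0) :
    (g : Matrix (Fin 3) (Fin 3) K) = !![(g : Matrix (Fin 3) (Fin 3) K) 0 0, (g : Matrix (Fin 3) (Fin 3) K) 0 1, (g : Matrix (Fin 3) (Fin 3) K) 0 2;
      0, (g : Matrix (Fin 3) (Fin 3) K) 1 1, (g : Matrix (Fin 3) (Fin 3) K) 1 2; 0, 0, (g : Matrix (Fin 3) (Fin 3) K) 2 2] := by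
  ext k l
  fin_cases k <;> fin_cases l <;> simp [h10, h20, h21]

/-- **Conjugating an integral UPPER TRIANGULAR matrix by `d = diag(z, 1, (σz)⁻¹)` keeps it integral** when `v z ≤ 1`, `v (σ z) ≤ 1`: the `(i,k)` entry is scaled by
`d_i ∕ d_k ∈ {1, z, σz, zσz}` above the diagonal. [cite: Rao1972, Theorem] -/
theorem isIntMatrix_conj_torusElt_of_lower_eq_zero {z : K} (hz : z ≠ 0) (hvz : Valued.v z ≤ 1) (hvσz : Valued.v (σ z) ≤ 1) {d g : GL (Fin 3) K}
    (hd : (d : Matrix (Fin 3) (Fin 3) K) = Matrix.diagonal ![z, 1, (σ z)⁻¹])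
    (h10 : (g : Matrix (Fin 3) (Fin 3) K) 1 0 = 0) (h20 : (g : Matrix (Fin 3) (Fin 3) K) 2 0 = 0) (h21 : (g : Matrix (Fin 3) (Fin 3) K) 2 1 = 0)
    (hint : IsIntMatrix (g : Matrix (Fin 3) (Fin 3) K)) :
    IsIntMatrix ((d * g * d⁻¹ : GL (Fin 3) K) : Matrix (Fin 3) (Fin 3) K) := by
  have hσz : σ z ≠ 0 := (map_ne_zero σ).2 hz
  have hconj := coe_diagonal_conj_upperTriangular hz one_ne_zero (inv_ne_zero hσz) hd (coe_eq_upperTriangular_of_lower_eq_zero h10 h20 h21)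
  rw [inv_one, inv_inv] at hconj
  have h00 := hint 0 0; have h01 := hint 0 1; have h02 := hint 0 2; have h11 := hint 1 1; have h12 := hint 1 2; have h22 := hint 2 2
  have hzz : Valued.v (z * σ z) ≤ 1 := by rw [Valuation.map_mul, ← mul_one (1 : ℤᵐ⁰)]; exact mul_le_mul' hvz hvσz
  have e01 : Valued.v z * Valued.v ((g : Matrix (Fin 3) (Fin 3) K) 0 1) ≤ 1 := by
    rw [← mul_one (1 : ℤᵐ⁰)]; exact mul_le_mul' hvz h01
  have e02 : Valued.v z * Valued.v ((g : Matrix (Fin 3) (Fin 3) K) 0 2) * Valued.v (σ z) ≤ 1 := by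
    rw [mul_assoc, mul_comm (Valued.v ((g : Matrix (Fin 3) (Fin 3) K) 0 2)), ← mul_assoc, ← Valuation.map_mul, ← mul_one (1 : ℤᵐ⁰)]
    exact mul_le_mul' hzz h02
  have e12 : Valued.v ((g : Matrix (Fin 3) (Fin 3) K) 1 2) * Valued.v (σ z) ≤ 1 := by
    rw [← mul_one (1 : ℤᵐ⁰)]; exact mul_le_mul' h12 hvσz
  rw [IsIntMatrix, hconj]
  intro k l
  fin_cases k <;> fin_cases l <;> simp [h00, h11, h22, e01, e02, e12]

/-- **MONOTONICITY `S_j ≤ S_{j+1}`** for the shell subgroups of the corner transvection `u₀ = n(t₀)` (`t₀ ≠ 0`) and `d = diag(z, 1, (σz)⁻¹)` with `v z ≤ 1`, `v (σz) ≤ 1`: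
`h = d^j g d^{−j}` commutes with `d^j u₀ d^{−j} = n((zσz)^j t₀)`, hence is upper triangular, hence `d h d⁻¹ = d^{j+1} g d^{−(j+1)}` stays integral (and likewise for the inverses).
[cite: Rao1972, Theorem] [cite: Rogawski1990, §8.1 p. 112] -/
theorem shell_le_shell_succ {t₀ z : K} (ht₀ : t₀ ≠ 0) (hz : z ≠ 0) (hvz : Valued.v z ≤ 1) (hvσz : Valued.v (σ z) ≤ 1)
    {u d : GL (Fin 3) K} (hu : (u : Matrix (Fin 3) (Fin 3) K) = !![1, 0, t₀; 0, 1, 0; 0, 0, 1]) (hd : (d : Matrix (Fin 3) (Fin 3) K) = Matrix.diagonal ![z, 1, (σ z)⁻¹])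
    {S : ℤ → Subgroup (GL (Fin 3) K)}
    (hS : ∀ (j : ℤ) (g : GL (Fin 3) K), g ∈ S j ↔ g ∈ unitaryGroupOfForm σ ((StdForm.antidiagonal 3).over K) ∧ g * u = u * g ∧
      IsIntMatrix ((d ^ j * g * (d ^ j)⁻¹ : GL (Fin 3) K) : Matrix (Fin 3) (Fin 3) K) ∧
      IsIntMatrix (((d ^ j * g * (d ^ j)⁻¹)⁻¹ : GL (Fin 3) K) : Matrix (Fin 3) (Fin 3) K))
    (j : ℤ) : S j ≤ S (j + 1) := by
  intro g hgS
  obtain ⟨hg, hgc, hgi, hgi'⟩ := (hS j g).1 hgS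
  have hσz : σ z ≠ 0 := (map_ne_zero σ).2 hz
  -- the conjugated transvection `u′ = d^j u₀ d^{−j} = n((zσz)^j t₀)` and the conjugated element `h`
  have hu' : ((d ^ j * u * (d ^ j)⁻¹ : GL (Fin 3) K) : Matrix (Fin 3) (Fin 3) K) = !![1, 0, (z * σ z) ^ j * t₀; 0, 1, 0; 0, 0, 1] := by
    rw [coe_torusElt_zpow_conj_upperTriangularUnipotent σ hz hd hu j, mul_zero, mul_zero]
  have ht' : (z * σ z) ^ j * t₀ ≠ 0 := mul_ne_zero (zpow_ne_zero j (mul_ne_zero hz hσz)) ht₀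
  have hcomm : ∀ {x : GL (Fin 3) K}, x * u = u * x → (d ^ j * x * (d ^ j)⁻¹) * (d ^ j * u * (d ^ j)⁻¹) = (d ^ j * u * (d ^ j)⁻¹) * (d ^ j * x * (d ^ j)⁻¹) := by
    intro x hx
    have : d ^ j * x * (d ^ j)⁻¹ * (d ^ j * u * (d ^ j)⁻¹) = d ^ j * (x * u) * (d ^ j)⁻¹ := by group
    rw [this, hx]; group
  have hginv_c : g⁻¹ * u = u * g⁻¹ := by rw [inv_mul_eq_iff_eq_mul, ← mul_assoc, hgc, mul_assoc, mul_inv_cancel, mul_one]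
  -- lower entries of `h = d^j g d^{−j}` and of `h⁻¹` vanish
  obtain ⟨h10, h20, h21, -⟩ := lower_eq_zero_of_commute_cornerUnipotent ht' hu' (hcomm hgc)
  have hinv_eq : (d ^ j * g * (d ^ j)⁻¹)⁻¹ = d ^ j * g⁻¹ * (d ^ j)⁻¹ := by group
  obtain ⟨k10, k20, k21, -⟩ := lower_eq_zero_of_commute_cornerUnipotent ht' hu' (hcomm hginv_c)
  rw [← hinv_eq] at k10 k20 k21
  -- one more conjugation by `d`
  have hstep : d ^ (j + 1) * g * (d ^ (j + 1))⁻¹ = d * (d ^ j * g * (d ^ j)⁻¹) * d⁻¹ := by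
    rw [_root_.zpow_add_one, show d ^ j * d = d * d ^ j from by simpa using zpow_mul_comm d j 1]; group
  have hstep' : (d ^ (j + 1) * g * (d ^ (j + 1))⁻¹)⁻¹ = d * (d ^ j * g * (d ^ j)⁻¹)⁻¹ * d⁻¹ := by rw [hstep]; group
  refine (hS (j + 1) g).2 ⟨hg, hgc, ?_, ?_⟩
  · rw [hstep]; exact isIntMatrix_conj_torusElt_of_lower_eq_zero σ hz hvz hvσz hd h10 h20 h21 hgi
  · rw [hstep']; exact isIntMatrix_conj_torusElt_of_lower_eq_zero σ hz hvz hvσz hd k10 k20 k21 hgi'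

/-- **MONOTONICITY `S_{j₀} ≤ S_j` for `j₀ ≤ j`.** [cite: Rao1972, Theorem] -/
theorem shell_mono {t₀ z : K} (ht₀ : t₀ ≠ 0) (hz : z ≠ 0) (hvz : Valued.v z ≤ 1) (hvσz : Valued.v (σ z) ≤ 1)
    {u d : GL (Fin 3) K} (hu : (u : Matrix (Fin 3) (Fin 3) K) = !![1, 0, t₀; 0, 1, 0; 0, 0, 1]) (hd : (d : Matrix (Fin 3) (Fin 3) K) = Matrix.diagonal ![z, 1, (σ z)⁻¹])
    {S : ℤ → Subgroup (GL (Fin 3) K)}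
    (hS : ∀ (j : ℤ) (g : GL (Fin 3) K), g ∈ S j ↔ g ∈ unitaryGroupOfForm σ ((StdForm.antidiagonal 3).over K) ∧ g * u = u * g ∧
      IsIntMatrix ((d ^ j * g * (d ^ j)⁻¹ : GL (Fin 3) K) : Matrix (Fin 3) (Fin 3) K) ∧
      IsIntMatrix (((d ^ j * g * (d ^ j)⁻¹)⁻¹ : GL (Fin 3) K) : Matrix (Fin 3) (Fin 3) K))
    {j₀ j : ℤ} (hj : j₀ ≤ j) : S j₀ ≤ S j := by
  obtain ⟨n, hn⟩ := Int.eq_ofNat_of_zero_le (sub_nonneg.2 hj)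
  have hj' : j = j₀ + n := by omega
  subst hj'
  clear hj hn
  induction n with
  | zero => simp
  | succ n ih =>
    rw [Nat.cast_succ, ← add_assoc]
    exact ih.trans (shell_le_shell_succ σ ht₀ hz hvz hvσz hu hd hS _)

end Monotone

/-! ## §3 Absorption and strict growth -/

section Growth

/-- **ABSORPTION** (GL-level form of `k · d^j · s ∈ U_int · {d^j}`): for `s ∈ S_j` and an integral `k` with integral inverse, `k · d^j · s = k′ · d^j` with `k′ = k · (d^j s d^{−j})`
integral with integral inverse. [cite: Rao1972, Theorem] -/
theorem exists_mul_zpow_mul_eq_mul_zpow {u d : GL (Fin 3) K} {S : ℤ → Subgroup (GL (Fin 3) K)}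
    (hS : ∀ (j : ℤ) (g : GL (Fin 3) K), g ∈ S j ↔ g ∈ unitaryGroupOfForm σ ((StdForm.antidiagonal 3).over K) ∧ g * u = u * g ∧
      IsIntMatrix ((d ^ j * g * (d ^ j)⁻¹ : GL (Fin 3) K) : Matrix (Fin 3) (Fin 3) K) ∧
      IsIntMatrix (((d ^ j * g * (d ^ j)⁻¹)⁻¹ : GL (Fin 3) K) : Matrix (Fin 3) (Fin 3) K))
    {j : ℤ} {k s : GL (Fin 3) K} (hk : IsIntMatrix (k : Matrix (Fin 3) (Fin 3) K)) (hki : IsIntMatrix ((k⁻¹ : GL (Fin 3) K) : Matrix (Fin 3) (Fin 3) K))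
    (hs : s ∈ S j) :
    ∃ k' : GL (Fin 3) K, IsIntMatrix (k' : Matrix (Fin 3) (Fin 3) K) ∧ IsIntMatrix ((k'⁻¹ : GL (Fin 3) K) : Matrix (Fin 3) (Fin 3) K) ∧ k * d ^ j * s = k' * d ^ j := by
  obtain ⟨-, -, hsi, hsi'⟩ := (hS j s).1 hs
  refine ⟨k * (d ^ j * s * (d ^ j)⁻¹), ?_, ?_, by group⟩
  · rw [Units.val_mul]; exact isIntMatrix_mul hk hsi
  · rw [_root_.mul_inv_rev, Units.val_mul]; exact isIntMatrix_mul hsi' hki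

/-- **THE STRICTNESS WITNESS** `w_j = !![1, z^{−(j+1)}, −(zσz)^{−(j+1)}∕2; 0, 1, −(σz)^{−(j+1)}; 0, 0, 1]` lies in `S_{j+1}` but not in `S_j` (`σ` an isometric involution with
`σ 2 = 2`, `2 ∈ 𝒪^×`, `v z = exp(−1)`): hence `relIndex (S_j) (S_{j+1}) ≠ 1`. [cite: Rao1972, Theorem] -/
theorem relIndex_shell_succ_ne_one (hσ : ∀ x : K, σ (σ x) = x) (hv2 : Valued.v (2 : K) = 1)
    {t₀ z : K} (ht₀ : t₀ ≠ 0) (hz : Valued.v z = WithZero.exp (-1 : ℤ))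
    {u d : GL (Fin 3) K} (hu : (u : Matrix (Fin 3) (Fin 3) K) = !![1, 0, t₀; 0, 1, 0; 0, 0, 1]) (hd : (d : Matrix (Fin 3) (Fin 3) K) = Matrix.diagonal ![z, 1, (σ z)⁻¹])
    {S : ℤ → Subgroup (GL (Fin 3) K)}
    (hS : ∀ (j : ℤ) (g : GL (Fin 3) K), g ∈ S j ↔ g ∈ unitaryGroupOfForm σ ((StdForm.antidiagonal 3).over K) ∧ g * u = u * g ∧
      IsIntMatrix ((d ^ j * g * (d ^ j)⁻¹ : GL (Fin 3) K) : Matrix (Fin 3) (Fin 3) K) ∧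
      IsIntMatrix (((d ^ j * g * (d ^ j)⁻¹)⁻¹ : GL (Fin 3) K) : Matrix (Fin 3) (Fin 3) K))
    (j : ℤ) : (S j).relIndex (S (j + 1)) ≠ 1 := by
  have h2 : (2 : K) ≠ 0 := (Valuation.ne_zero_iff _).1 (by rw [hv2]; exact one_ne_zero)
  have hz0 : z ≠ 0 := (Valuation.ne_zero_iff _).1 (by rw [hz]; exact WithZero.coe_ne_zero)
  have hσz0 : σ z ≠ 0 := (map_ne_zero σ).2 hz0
  have hN0 : z * σ z ≠ 0 := mul_ne_zero hz0 hσz0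
  -- the witness
  obtain ⟨w, hw, -⟩ := exists_units_coe_eq_upperTriangularUnipotent (z ^ (-(j + 1))) (-((z * σ z) ^ (-(j + 1))) / 2) (-(σ z) ^ (-(j + 1)))
  have hwU : w ∈ unitaryGroupOfForm σ ((StdForm.antidiagonal 3).over K) := by
    refine (mem_unitaryGroupOfForm_iff_of_coe_eq_upperUnipotent σ hσ hw).2 ⟨by rw [map_zpow₀], ?_⟩
    have hσN : σ (z * σ z) = z * σ z := by rw [map_mul, hσ, mul_comm]
    rw [map_div₀, map_neg, map_zpow₀, hσN, map_ofNat, map_zpow₀, mul_zpow]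
    field_simp
    ring
  have hwc : w * u = u * w := by
    refine Units.ext ?_
    rw [Units.val_mul, Units.val_mul, hu]
    exact (mul_cornerUnipotent_eq_cornerUnipotent_mul_iff ht₀ _).2 (by rw [hw]; simp)
  -- `w ∈ S (j+1)`: after conjugation by `d^{j+1}` the entries are `1, −1∕2, −1`
  have hconj1 : ((d ^ (j + 1) * w * (d ^ (j + 1))⁻¹ : GL (Fin 3) K) : Matrix (Fin 3) (Fin 3) K) = !![1, 1, -(1 : K) / 2; 0, 1, -1; 0, 0, 1] := by
    rw [coe_torusElt_zpow_conj_upperTriangularUnipotent σ hz0 hd hw (j + 1)]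
    have e1 : z ^ (j + 1) * z ^ (-(j + 1)) = 1 := by rw [← zpow_add₀ hz0, add_neg_cancel, zpow_zero]
    have e2 : (z * σ z) ^ (j + 1) * (-((z * σ z) ^ (-(j + 1))) / 2) = -(1 : K) / 2 := by
      rw [mul_div_assoc', mul_neg, ← zpow_add₀ hN0, add_neg_cancel, zpow_zero]
    have e3 : (σ z) ^ (j + 1) * (-(σ z) ^ (-(j + 1))) = -1 := by rw [mul_neg, ← zpow_add₀ hσz0, add_neg_cancel, zpow_zero]
    rw [e1, e2, e3]
  have hwS1 : w ∈ S (j + 1) := by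
    have hv1 : Valued.v (1 : K) ≤ 1 := by rw [map_one]
    have hvh : Valued.v (-(1 : K) / 2) ≤ 1 := by rw [map_div₀, Valuation.map_neg, map_one, hv2, div_one]
    have hvm : Valued.v (-(1 : K)) ≤ 1 := by rw [Valuation.map_neg, map_one]
    exact (hS (j + 1) w).2 ⟨hwU, hwc, (isIntMatrix_upperTriangularUnipotent_iff hconj1).2 ⟨hv1, hvh, hvm⟩,
      isIntMatrix_inv_of_upperTriangularUnipotent hconj1 hv1 hvh hvm⟩
  -- `w ∉ S j`: after conjugation by `d^j` the `(0,1)` entry is `z⁻¹`, of valuation `exp 1 > 1`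
  have hwS0 : w ∉ S j := by
    intro hmem
    obtain ⟨-, -, hint, -⟩ := (hS j w).1 hmem
    rw [coe_torusElt_zpow_conj_upperTriangularUnipotent σ hz0 hd hw j] at hint
    have h01 := hint 0 1
    have e : z ^ j * z ^ (-(j + 1)) = z⁻¹ := by rw [← zpow_add₀ hz0, show j + -(j + 1) = -1 by ring, _root_.zpow_neg_one]
    simp only [Matrix.of_apply, Matrix.cons_val', Matrix.cons_val_zero, Matrix.cons_val_one, Matrix.empty_val'] at h01
    rw [e, map_inv₀, hz, ← WithZero.exp_neg, neg_neg] at h01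
    have : ¬ (WithZero.exp (1 : ℤ) ≤ 1) := by rw [← WithZero.exp_zero, not_le]; exact WithZero.exp_lt_exp.2 one_pos
    exact this h01
  rw [Ne, Subgroup.relIndex_eq_one]
  exact fun hle => hwS0 (hle hwS1)

/-- **GROWTH `2^{j−j₀} ≤ [S_j : S_{j₀}]`** for the shell subgroups of a corner transvection, GIVEN that consecutive steps have finite index (on the CM carrier: compact-open
subgroups of the centraliser, ★ `relIndex_ne_zero_of_isCompact_of_isOpen`) — monotonicity `shell_le_shell_succ` + properness `relIndex_shell_succ_ne_one` + Lagrange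
`pow_two_le_relIndex_of_chain`.  This is the `hgr` clause of the generic shell sum with `N = 1`, `c₃ = 1`. [cite: Rao1972, Theorem] [cite: Rogawski1990, §8.1 p. 112] -/
theorem pow_two_le_relIndex_shell (hσ : ∀ x : K, σ (σ x) = x) (hσv : ∀ x : K, Valued.v (σ x) = Valued.v x) (hv2 : Valued.v (2 : K) = 1)
    {t₀ z : K} (ht₀ : t₀ ≠ 0) (hz : Valued.v z = WithZero.exp (-1 : ℤ))
    {u d : GL (Fin 3) K} (hu : (u : Matrix (Fin 3) (Fin 3) K) = !![1, 0, t₀; 0, 1, 0; 0, 0, 1]) (hd : (d : Matrix (Fin 3) (Fin 3) K) = Matrix.diagonal ![z, 1, (σ z)⁻¹])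
    {S : ℤ → Subgroup (GL (Fin 3) K)}
    (hS : ∀ (j : ℤ) (g : GL (Fin 3) K), g ∈ S j ↔ g ∈ unitaryGroupOfForm σ ((StdForm.antidiagonal 3).over K) ∧ g * u = u * g ∧
      IsIntMatrix ((d ^ j * g * (d ^ j)⁻¹ : GL (Fin 3) K) : Matrix (Fin 3) (Fin 3) K) ∧
      IsIntMatrix (((d ^ j * g * (d ^ j)⁻¹)⁻¹ : GL (Fin 3) K) : Matrix (Fin 3) (Fin 3) K))
    (hfin : ∀ j : ℤ, (S j).relIndex (S (j + 1)) ≠ 0) {j₀ j : ℤ} (hj : j₀ ≤ j) :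
    2 ^ (j - j₀).toNat ≤ (S j₀).relIndex (S j) := by
  have hz0 : z ≠ 0 := (Valuation.ne_zero_iff _).1 (by rw [hz]; exact WithZero.coe_ne_zero)
  have hvz : Valued.v z ≤ 1 := by rw [hz, ← WithZero.exp_zero]; exact WithZero.exp_le_exp.2 (by norm_num)
  have hvσz : Valued.v (σ z) ≤ 1 := by rw [hσv]; exact hvz
  exact pow_two_le_relIndex_of_chain S (shell_le_shell_succ σ ht₀ hz0 hvz hvσz hu hd hS) hfin
    (relIndex_shell_succ_ne_one σ hσ hv2 ht₀ hz hu hd hS) hj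

end Growth

end Literature.NumberTheory.Automorphic.UnitaryGroup
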